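import Summits.NavierStokesRegularity.NavierStokesRegularity.Theses.RootDecompLiouvilleHorizon
import Literature.Analysis.FluidPDE.NSCriticalClosureBesovBounded
import Literature.Analysis.FluidPDE.TaoLocalisationHolds
import Literature.Analysis.FluidPDE.KNSSTypeIIHolds
import Literature.Analysis.FluidPDE.KNSSTypeIIZoomIn
import HarnessLib

/-!
# Route `RootDecompLiouvilleHorizon` (N22): the two glue kills K1 `HorizonRecordKill` (stmt-32318),
# K2 `HorizonTypeIKill` (stmt-32319) and the support FR `LateRecordsExist` (stmt-32063) — PROVED

Def-free port of decomp-ns lens 5, gen 10 «HORIZON LADDER» (HOME/decomp-ns-lens-5/HorizonLadder.lean §3,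
§4, §7; critic rows 113 / 128 CLEARED, «K1/K2 PROVED … landing = port into Theorems (routine)»), stated on
the TREE decls of `Theses.RootDecompLiouvilleHorizon` (the lens's private copies `IsNearRecord`,
`IsViscousAt`, `RecordViscous`, `BlowupRung` are inlined).

* §1 frame lemmas for a maximal smooth Leray–Hopf solution on `[0,T)` from a rapidly decaying datum:
  bounded on closed slabs (Tao 2013, `exists_forall_norm_le_of_tao2011`), unbounded up to `T`
  (continuation criterion `hasSmoothExtensionPast_of_bounded_holds`), near-record fast points exist at
  times arbitrarily close to `T` (`exists_near_max`, KNSS 2009 §6) and are eventually as fast as we please;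
  the restart selection `exists_viscous_record_window`.
* §2 K1 — THE RESTART (arithmetic): under rung `ε` of the blow-up horizon Q♭ a blow-up is NOT
  `R`-viscous at a record subsequence whenever `4Rε < 1` (at a late near-record `(t,x)` the window `(0,t]`
  has `Sν ≤ (2‖u(t,x)‖)²t`, so the rung gives `ν‖∇u(t)‖∞ ≤ 4ε‖u(t,x)‖²`, while an `R`-viscous witness
  gives `‖u(t,x)‖² ≤ Rν‖∇u(t)(y)‖ ≤ 4Rε‖u(t,x)‖² < ‖u(t,x)‖²`); hence Q♭ and the residual E♯
  `NoRecordEulerianTypeII` make every blow-up of the frame Type I: `horizonRecordKill_proof`.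
* §3 K2 — THE TYPE-I SIDE WITHOUT (L): Q♭ on the windows `(0,t]` with the past bound
  `M_t = M₀ + (|C|+1)/√(T−t)` gives `(T−t)‖∇u(t)‖∞ ≤ c/2` eventually, the gradient floor G gives `≥ c`
  frequently: `horizonTypeIKill_proof`.  FR `lateRecordsExist_proof` is the frame lemma by name.

With G `TypeIGradientFloor` proved (`Theorems.RootDecompLiouvilleHorizonTypeIGradientFloor`), the route's
`closes (hQ) (hG) (hR) (hK1) (hK2)` is down to its two open cruxes Q♭ `BlowupHorizon` and E♯
`NoRecordEulerianTypeII`.  Axioms ⊆ {propext, Classical.choice, Quot.sound}; no `def`.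

Sources: [KochNadirashviliSereginSverak2009] arXiv:0709.3599 §6; [Tao2013Localisation]; decomp-ns lens-5
NODE-g10.md; writer g4 evidence GlueProofN22H.lean (k1_holds / k2_holds) on stmt-32318 / 32319.
-/

set_option linter.dupNamespace false

namespace Summit.NavierStokesRegularity.NavierStokesRegularity.Theorems.RootDecompLiouvilleHorizonKills

open scoped Topology
open Filter Set Literature.Analysis.FluidPDE
open Summit.NavierStokesRegularity.NavierStokesRegularity.Theses.RootDecompLiouvilleHorizon

/-! ## §1  Frame lemmas -/

section Frame

variable {ν T : ℝ} {u : ℝ → EuclideanSpace ℝ (Fin 3) → EuclideanSpace ℝ (Fin 3)}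
  {p : ℝ → EuclideanSpace ℝ (Fin 3) → ℝ}

/-- Boundedness on closed slabs `[0, T₁] × ℝ³`, `T₁ < T` (Tao 2013 localisation, tree
`exists_forall_norm_le_of_tao2011`). [cite: Tao2013Localisation, Thm 1.5] -/
theorem slab_bounded (hν : 0 < ν) (hmax : IsMaximalSmoothSolution ν 0 u p T)
    (hLH : IsLerayHopfOn T ν 0 (u 0) u) (hdec : HasRapidSpatialDecay (u 0)) :
    ∀ T₁ ∈ Ioo 0 T, ∃ M : ℝ, ∀ t ∈ Icc 0 T₁, ∀ x, ‖u t x‖ ≤ M :=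
  exists_forall_norm_le_of_tao2011 tao2011_hasBoundedSobolevNormsOn_holds hν hmax.1 hLH hdec

/-- Unboundedness up to `T`: maximality + the continuation criterion
`hasSmoothExtensionPast_of_bounded_holds`. [cite: KochNadirashviliSereginSverak2009, §6] -/
theorem unbounded (hν : 0 < ν) (hT : 0 < T) (hmax : IsMaximalSmoothSolution ν 0 u p T)
    (hLH : IsLerayHopfOn T ν 0 (u 0) u) (hdec : HasRapidSpatialDecay (u 0)) (K : ℝ) :
    ∃ t ∈ Ioo 0 T, ∃ x : EuclideanSpace ℝ (Fin 3), K < ‖u t x‖ := by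
  by_contra h
  push Not at h
  obtain ⟨M₀, hM₀⟩ := slab_bounded hν hmax hLH hdec (T / 2) ⟨by positivity, by linarith⟩
  refine hmax.2 (hasSmoothExtensionPast_of_bounded_holds hν hT hmax.1 hLH ⟨max K M₀, fun t ht x => ?_⟩)
  rcases ht.1.eq_or_lt with h0 | h0
  · rw [← h0]
    exact (hM₀ 0 ⟨le_rfl, by positivity⟩ x).trans (le_max_right _ _)
  · exact (h t ⟨h0, ht.2⟩ x).trans (le_max_left _ _)

/-- Eventually, every near-record fast point is as fast as we please. -/
theorem eventually_nearRecord_large (hν : 0 < ν) (hT : 0 < T)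
    (hmax : IsMaximalSmoothSolution ν 0 u p T) (hLH : IsLerayHopfOn T ν 0 (u 0) u)
    (hdec : HasRapidSpatialDecay (u 0)) (K : ℝ) :
    ∀ᶠ t in 𝓝[<] T, ∀ x : EuclideanSpace ℝ (Fin 3),
      (∀ s ∈ Set.Ioc 0 t, ∀ y : EuclideanSpace ℝ (Fin 3), ‖u s y‖ ≤ 2 * ‖u t x‖) → K < 2 * ‖u t x‖ := by
  obtain ⟨t₀, ht₀, x₀, hx₀⟩ := unbounded hν hT hmax hLH hdec K
  filter_upwards [Ioo_mem_nhdsLT ht₀.2] with t ht x hrec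
  exact hx₀.trans_le (hrec t₀ ⟨ht₀.1, ht.1.le⟩ x₀)

/-- FR: near-record fast points occur at times arbitrarily close to `T` (KNSS 2009 §6 selection,
tree `exists_near_max`). [cite: KochNadirashviliSereginSverak2009, §6 (arXiv p. 11)] -/
theorem frequently_nearRecord (hν : 0 < ν) (hT : 0 < T) (hmax : IsMaximalSmoothSolution ν 0 u p T)
    (hLH : IsLerayHopfOn T ν 0 (u 0) u) (hdec : HasRapidSpatialDecay (u 0)) :
    ∃ᶠ t in 𝓝[<] T, ∃ x : EuclideanSpace ℝ (Fin 3), 1 ≤ ‖u t x‖ ∧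
      ∀ s ∈ Set.Ioc 0 t, ∀ y : EuclideanSpace ℝ (Fin 3), ‖u s y‖ ≤ 2 * ‖u t x‖ := by
  have hbdd := slab_bounded hν hmax hLH hdec
  have hbdd' : ∀ T' < T, ∃ M : ℝ, ∀ t ∈ Ioo 0 T', ∀ x, ‖u t x‖ ≤ M := by
    intro T' hT'
    rcases le_or_gt T' 0 with h | h
    · exact ⟨0, fun t ht _ => absurd (ht.1.trans ht.2) (not_lt.2 h)⟩
    · obtain ⟨M, hM⟩ := hbdd T' ⟨h, hT'⟩
      exact ⟨M, fun t ht x => hM t ⟨ht.1.le, ht.2.le⟩ x⟩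
  have hunb : ¬ ∃ M : ℝ, ∀ t ∈ Ioo 0 T, ∀ x, ‖u t x‖ ≤ M := by
    rintro ⟨M, hM⟩
    obtain ⟨t, ht, x, hx⟩ := unbounded hν hT hmax hLH hdec M
    exact (not_le.2 hx) (hM t ht x)
  rw [(nhdsLT_basis T).frequently_iff]
  intro t₀ ht₀
  obtain ⟨M₁, hM₁⟩ := hbdd (max t₀ (T / 2)) ⟨lt_max_of_lt_right (by positivity), max_lt ht₀ (by linarith)⟩
  obtain ⟨t, ht, x, hx, hrec⟩ := exists_near_max hbdd' hunb (max M₁ 1)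
  refine ⟨t, ⟨?_, ht.2⟩, x, (le_max_right _ _).trans hx.le, hrec⟩
  by_contra hle
  push Not at hle
  have := hM₁ t ⟨ht.1.le, hle.trans (le_max_left _ _)⟩ x
  linarith [le_max_left M₁ 1]

/-- THE RESTART SELECTION: if `u` is `R`-viscous at a record subsequence then for every window
constant `S` there is a late near-record fast point `(t, x)`, `R`-viscous, whose window `(0, t]`
satisfies `S·ν ≤ (2‖u(t,x)‖)²·t`. -/
theorem exists_viscous_record_window (hν : 0 < ν) (hT : 0 < T)
    (hmax : IsMaximalSmoothSolution ν 0 u p T) (hLH : IsLerayHopfOn T ν 0 (u 0) u)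
    (hdec : HasRapidSpatialDecay (u 0)) {R : ℝ}
    (hH : ∃ᶠ t in 𝓝[<] T, ∃ x : EuclideanSpace ℝ (Fin 3), 1 ≤ ‖u t x‖ ∧
      (∀ s ∈ Set.Ioc 0 t, ∀ y : EuclideanSpace ℝ (Fin 3), ‖u s y‖ ≤ 2 * ‖u t x‖) ∧
      ∃ y : EuclideanSpace ℝ (Fin 3), ‖u t x‖ ^ 2 ≤ R * ν * ‖fderiv ℝ (u t) y‖) (S : ℝ) :
    ∃ t ∈ Ioo 0 T, ∃ x : EuclideanSpace ℝ (Fin 3), 1 ≤ ‖u t x‖ ∧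
      (∀ s ∈ Set.Ioc 0 t, ∀ y : EuclideanSpace ℝ (Fin 3), ‖u s y‖ ≤ 2 * ‖u t x‖) ∧
      (∃ y : EuclideanSpace ℝ (Fin 3), ‖u t x‖ ^ 2 ≤ R * ν * ‖fderiv ℝ (u t) y‖) ∧
      S * ν ≤ (2 * ‖u t x‖) ^ 2 * t := by
  have hlarge := eventually_nearRecord_large hν hT hmax hLH hdec (S * ν / T)
  have hlate : ∀ᶠ t in 𝓝[<] T, t ∈ Ioo (T / 2) T := Ioo_mem_nhdsLT (by linarith)
  have hpos : ∀ᶠ t in 𝓝[<] T, t ∈ Ioo 0 T := Ioo_mem_nhdsLT hT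
  obtain ⟨t, ⟨x, hx1, hrec, hvis⟩, ⟨hK, hT2⟩, ht⟩ :=
    (hH.and_eventually ((hlarge.and hlate).and hpos)).exists
  refine ⟨t, ht, x, hx1, hrec, hvis, ?_⟩
  have hM : S * ν / T < 2 * ‖u t x‖ := hK x hrec
  have hMT : S * ν < 2 * ‖u t x‖ * T := (div_lt_iff₀ hT).1 hM
  have hnn : (0 : ℝ) ≤ 2 * ‖u t x‖ * T := by positivity
  calc S * ν ≤ 2 * ‖u t x‖ * T := hMT.le
    _ ≤ (2 * ‖u t x‖) ^ 2 * (T / 2) := by nlinarith [mul_le_mul_of_nonneg_right hx1 hnn]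
    _ ≤ (2 * ‖u t x‖) ^ 2 * t := mul_le_mul_of_nonneg_left hT2.1.le (sq_nonneg _)

end Frame

/-! ## §2  K1 — the restart: rung `ε` empties the Reynolds cell `4Rε < 1` along the records -/

section Restart

variable {ν T : ℝ} {u : ℝ → EuclideanSpace ℝ (Fin 3) → EuclideanSpace ℝ (Fin 3)}
  {p : ℝ → EuclideanSpace ℝ (Fin 3) → ℝ}

/-- RESTART.  Under rung `ε` of the blow-up horizon, a blow-up in the frame is NOT `R`-viscous at a
record subsequence for any `R` with `4Rε < 1`. [cite: KochNadirashviliSereginSverak2009, §6] -/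
theorem not_frequently_viscous_of_rung {ε : ℝ}
    (hH : ∃ S : ℝ, 0 < S ∧ ∀ (ν T : ℝ), 0 < ν → 0 < T →
      ∀ (u : ℝ → EuclideanSpace ℝ (Fin 3) → EuclideanSpace ℝ (Fin 3)) (p : ℝ → EuclideanSpace ℝ (Fin 3) → ℝ),
      Literature.Analysis.FluidPDE.IsMaximalSmoothSolution ν 0 u p T →
      Literature.Analysis.FluidPDE.IsLerayHopfOn T ν 0 (u 0) u →
      Literature.Analysis.FluidPDE.HasRapidSpatialDecay (u 0) →
      ∀ t ∈ Set.Ioo 0 T, ∀ M : ℝ, S * ν ≤ M ^ 2 * t →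
      (∀ s ∈ Set.Ioc 0 t, ∀ y : EuclideanSpace ℝ (Fin 3), ‖u s y‖ ≤ M) →
      ∀ y : EuclideanSpace ℝ (Fin 3), ν * ‖fderiv ℝ (u t) y‖ ≤ ε * M ^ 2)
    (hν : 0 < ν) (hT : 0 < T) (hmax : IsMaximalSmoothSolution ν 0 u p T)
    (hLH : IsLerayHopfOn T ν 0 (u 0) u) (hdec : HasRapidSpatialDecay (u 0)) {R : ℝ}
    (hRε : 4 * R * ε < 1) :
    ¬ ∃ᶠ t in 𝓝[<] T, ∃ x : EuclideanSpace ℝ (Fin 3), 1 ≤ ‖u t x‖ ∧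
      (∀ s ∈ Set.Ioc 0 t, ∀ y : EuclideanSpace ℝ (Fin 3), ‖u s y‖ ≤ 2 * ‖u t x‖) ∧
      ∃ y : EuclideanSpace ℝ (Fin 3), ‖u t x‖ ^ 2 ≤ R * ν * ‖fderiv ℝ (u t) y‖ := by
  intro hfr
  obtain ⟨S, _hS, hrung⟩ := hH
  obtain ⟨t, ht, x, hx1, hrec, ⟨y, hvis⟩, hwin⟩ :=
    exists_viscous_record_window hν hT hmax hLH hdec hfr S
  have hgrad : ν * ‖fderiv ℝ (u t) y‖ ≤ ε * (2 * ‖u t x‖) ^ 2 :=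
    hrung ν T hν hT u p hmax hLH hdec t ht (2 * ‖u t x‖) hwin hrec y
  have hg : 0 ≤ ν * ‖fderiv ℝ (u t) y‖ := by positivity
  rcases le_or_gt R 0 with hR | hR
  · have h1 : R * ν * ‖fderiv ℝ (u t) y‖ ≤ 0 := by
      have : R * (ν * ‖fderiv ℝ (u t) y‖) ≤ 0 := mul_nonpos_of_nonpos_of_nonneg hR hg
      simpa [mul_assoc] using this
    nlinarith [hvis, h1, hx1]
  · have h2 : ‖u t x‖ ^ 2 ≤ 4 * R * ε * ‖u t x‖ ^ 2 := by
      calc ‖u t x‖ ^ 2 ≤ R * ν * ‖fderiv ℝ (u t) y‖ := hvis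
        _ = R * (ν * ‖fderiv ℝ (u t) y‖) := by ring
        _ ≤ R * (ε * (2 * ‖u t x‖) ^ 2) := mul_le_mul_of_nonneg_left hgrad hR.le
        _ = 4 * R * ε * ‖u t x‖ ^ 2 := by ring
    have ha2 : 0 < ‖u t x‖ ^ 2 := by positivity
    have h3 : 4 * R * ε * ‖u t x‖ ^ 2 < 1 * ‖u t x‖ ^ 2 := mul_lt_mul_of_pos_right hRε ha2
    linarith

/-- ALL RUNGS: under Q♭ `BlowupHorizon` no blow-up in the frame is viscous at a record subsequence
(take the rung `ε = 1/(4|R|+4)`, so that `4Rε < 1`). -/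
theorem not_recordViscous_of_blowupHorizon (hQ : BlowupHorizon) (hν : 0 < ν) (hT : 0 < T)
    (hmax : IsMaximalSmoothSolution ν 0 u p T) (hLH : IsLerayHopfOn T ν 0 (u 0) u)
    (hdec : HasRapidSpatialDecay (u 0)) :
    ¬ (∃ R : ℝ, ∃ᶠ t in nhdsWithin T (Set.Iio T), ∃ x : EuclideanSpace ℝ (Fin 3), 1 ≤ ‖u t x‖ ∧
      (∀ s ∈ Set.Ioc 0 t, ∀ y : EuclideanSpace ℝ (Fin 3), ‖u s y‖ ≤ 2 * ‖u t x‖) ∧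
      ∃ y : EuclideanSpace ℝ (Fin 3), ‖u t x‖ ^ 2 ≤ R * ν * ‖fderiv ℝ (u t) y‖) := by
  rintro ⟨R, hR⟩
  have hε : (0 : ℝ) < 1 / (4 * |R| + 4) := by positivity
  refine not_frequently_viscous_of_rung (hQ _ hε) hν hT hmax hLH hdec ?_ hR
  rw [show 4 * R * (1 / (4 * |R| + 4)) = 4 * R / (4 * |R| + 4) by ring, div_lt_one (by positivity)]
  linarith [le_abs_self R]

end Restart

/-- **K1 `HorizonRecordKill` (item stmt-NavierStokesRegularity-32318), PROVED**: Q♭ and the residual E♯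
make every maximal smooth Leray–Hopf blow-up of the frame Type I — E♯ asks exactly for the negation
that `not_recordViscous_of_blowupHorizon` supplies. -/
theorem horizonRecordKill_proof : HorizonRecordKill :=
  fun hQ hR ν T hν hT u p hmax hLH hdec =>
    hR ν T hν hT u p hmax hLH hdec (not_recordViscous_of_blowupHorizon hQ hν hT hmax hLH hdec)

/-- **FR `LateRecordsExist` (item stmt-NavierStokesRegularity-32063), PROVED**: the frame lemma
`frequently_nearRecord` by name. -/
theorem lateRecordsExist_proof : LateRecordsExist :=
  fun _ν _T hν hT _u _p hmax hLH hdec => frequently_nearRecord hν hT hmax hLH hdec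

/-! ## §3  K2 — the Type-I side without (L) -/

section TypeI

variable {ν T : ℝ} {u : ℝ → EuclideanSpace ℝ (Fin 3) → EuclideanSpace ℝ (Fin 3)}
  {p : ℝ → EuclideanSpace ℝ (Fin 3) → ℝ}

/-- Q♭ and the gradient floor G exclude Type-I blow-up in the frame: Q♭ on the windows `(0,t]` with
the past bound `M_t = M₀ + (|C|+1)/√(T−t)` gives `(T−t)‖∇u(t)(y)‖ ≤ c/2` eventually (rung
`ε = cν/(8(|C|+1)²)`), while G gives `≥ c` frequently. [cite: KochNadirashviliSereginSverak2009, §6] -/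
theorem not_typeI_of_blowupHorizon_floor (hQ : BlowupHorizon) (hG : TypeIGradientFloor) (hν : 0 < ν)
    (hT : 0 < T) (hmax : IsMaximalSmoothSolution ν 0 u p T) (hLH : IsLerayHopfOn T ν 0 (u 0) u)
    (hdec : HasRapidSpatialDecay (u 0)) : ¬ IsTypeIBlowup u T := by
  intro hI
  obtain ⟨c, hc, hfreq⟩ := hG ν T hν hT u p hmax hLH hdec hI
  obtain ⟨C, hC⟩ := hI
  obtain ⟨t₁, ht₁T, hC'⟩ := (nhdsLT_basis T).eventually_iff.1 hC
  set C₁ : ℝ := |C| + 1 with hC₁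
  have hC₁pos : 0 < C₁ := by positivity
  have hC₁ge : 1 ≤ C₁ := by
    have := abs_nonneg C
    linarith
  have hCC₁ : C ≤ C₁ := (le_abs_self C).trans (by linarith)
  -- slab bound up to `t₂ = max t₁ (T/2)`
  set t₂ : ℝ := max t₁ (T / 2) with ht₂
  have ht₂T : t₂ < T := max_lt ht₁T (by linarith)
  have ht₂pos : 0 < t₂ := lt_max_of_lt_right (by positivity)
  obtain ⟨M₀, hM₀⟩ := slab_bounded hν hmax hLH hdec t₂ ⟨ht₂pos, ht₂T⟩
  have hM₀nn : 0 ≤ M₀ := (norm_nonneg _).trans (hM₀ 0 ⟨le_rfl, ht₂pos.le⟩ 0)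
  -- the past bound at a late time `t`
  have hpast : ∀ t ∈ Ioo t₂ T, ∀ s ∈ Ioc 0 t, ∀ y : EuclideanSpace ℝ (Fin 3),
      ‖u s y‖ ≤ M₀ + C₁ / Real.sqrt (T - t) := by
    intro t ht s hs y
    have hTt : 0 < T - t := sub_pos.2 ht.2
    have hsq : 0 < Real.sqrt (T - t) := Real.sqrt_pos.2 hTt
    have hterm : 0 ≤ C₁ / Real.sqrt (T - t) := by positivity
    rcases le_or_gt s t₂ with hs₂ | hs₂
    · exact (hM₀ s ⟨hs.1.le, hs₂⟩ y).trans (le_add_of_nonneg_right hterm)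
    · have hs₁ : s ∈ Ioo t₁ T := ⟨(le_max_left _ _).trans_lt hs₂, hs.2.trans_lt ht.2⟩
      have h1 : ‖u s y‖ ≤ C / Real.sqrt (T - s) := hC' hs₁ y
      have hsqle : Real.sqrt (T - t) ≤ Real.sqrt (T - s) := Real.sqrt_le_sqrt (by linarith [hs.2])
      have h2 : C / Real.sqrt (T - s) ≤ C₁ / Real.sqrt (T - t) :=
        calc C / Real.sqrt (T - s) ≤ C₁ / Real.sqrt (T - s) :=
              div_le_div_of_nonneg_right hCC₁ (Real.sqrt_nonneg _)
          _ ≤ C₁ / Real.sqrt (T - t) := div_le_div_of_nonneg_left hC₁pos.le hsq hsqle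
      exact h1.trans (h2.trans (le_add_of_nonneg_left hM₀nn))
  -- Q♭ at `ε = c ν / (8 C₁²)`
  have hε : 0 < c * ν / (8 * C₁ ^ 2) := by positivity
  obtain ⟨S, hS, hrung⟩ := hQ _ hε
  -- the late window
  have hev : ∀ᶠ t in 𝓝[<] T, t ∈ Ioo t₂ T ∧ (T - t) * (2 * S * ν) ≤ T ∧ (T - t) * M₀ ^ 2 ≤ C₁ ^ 2 := by
    have h1 : ∀ᶠ t in 𝓝[<] T, t ∈ Ioo t₂ T := Ioo_mem_nhdsLT ht₂T
    set δ : ℝ := min (T / (2 * S * ν)) (C₁ ^ 2 / (M₀ ^ 2 + 1)) with hδ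
    have hδpos : 0 < δ := by positivity
    have h2 : ∀ᶠ t in 𝓝[<] T, t ∈ Ioo (T - δ) T := Ioo_mem_nhdsLT (by linarith)
    filter_upwards [h1, h2] with t ht1 ht2
    have hTt : 0 ≤ T - t := by linarith [ht1.2]
    have hlt : T - t < δ := by linarith [ht2.1]
    refine ⟨ht1, ?_, ?_⟩
    · have : T - t ≤ T / (2 * S * ν) := hlt.le.trans (min_le_left _ _)
      rwa [le_div_iff₀ (by positivity)] at this
    · have hle : T - t ≤ C₁ ^ 2 / (M₀ ^ 2 + 1) := hlt.le.trans (min_le_right _ _)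
      rw [le_div_iff₀ (by positivity)] at hle
      nlinarith [hle, hTt]
  -- eventually the scaled gradient is ≤ c/2
  have hsmall : ∀ᶠ t in 𝓝[<] T, ∀ y : EuclideanSpace ℝ (Fin 3),
      (T - t) * ‖fderiv ℝ (u t) y‖ ≤ c / 2 := by
    filter_upwards [hev] with t ⟨ht, hwinT, hM₀C⟩ y
    have hTt : 0 < T - t := sub_pos.2 ht.2
    have hsq : 0 < Real.sqrt (T - t) := Real.sqrt_pos.2 hTt
    have hsq2 : Real.sqrt (T - t) ^ 2 = T - t := Real.sq_sqrt hTt.le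
    set M : ℝ := M₀ + C₁ / Real.sqrt (T - t) with hM
    have ht0T : t ∈ Ioo 0 T := ⟨ht₂pos.trans ht.1, ht.2⟩
    have hMge : C₁ / Real.sqrt (T - t) ≤ M := le_add_of_nonneg_left hM₀nn
    have hMnn : 0 ≤ M := le_trans (by positivity) hMge
    have hM2 : C₁ ^ 2 ≤ M ^ 2 * (T - t) := by
      have h1 : (C₁ / Real.sqrt (T - t)) ^ 2 ≤ M ^ 2 := pow_le_pow_left₀ (by positivity) hMge 2
      have h2 : (C₁ / Real.sqrt (T - t)) ^ 2 * (T - t) = C₁ ^ 2 := by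
        rw [div_pow, hsq2]
        field_simp
      nlinarith [h1, hTt.le]
    have hwin : S * ν ≤ M ^ 2 * t := by
      have hSν : 0 < S * ν := by positivity
      have ht2' : T / 2 < t := (le_max_right _ _).trans_lt ht.1
      have hA : S * ν * (T - t) ≤ t := by nlinarith [hwinT, ht2']
      calc S * ν = S * ν * 1 := by ring
        _ ≤ S * ν * (M ^ 2 * (T - t)) := by
            apply mul_le_mul_of_nonneg_left _ hSν.le
            nlinarith [hM2, hC₁ge]
        _ = M ^ 2 * (S * ν * (T - t)) := by ring
        _ ≤ M ^ 2 * t := mul_le_mul_of_nonneg_left hA (sq_nonneg _)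
    have hgrad := hrung ν T hν hT u p hmax hLH hdec t ht0T M hwin (hpast t ht) y
    have hM₀le : M₀ ≤ C₁ / Real.sqrt (T - t) := by
      rw [le_div_iff₀ hsq]
      have h1 : (M₀ * Real.sqrt (T - t)) ^ 2 ≤ C₁ ^ 2 := by
        rw [mul_pow, hsq2]
        nlinarith [hM₀C]
      exact (pow_le_pow_iff_left₀ (by positivity) hC₁pos.le two_ne_zero).1 h1
    have hMle : M ≤ 2 * (C₁ / Real.sqrt (T - t)) := by
      simp only [hM]
      linarith
    have hM2le : M ^ 2 * (T - t) ≤ 4 * C₁ ^ 2 := by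
      have h1 : M ^ 2 ≤ (2 * (C₁ / Real.sqrt (T - t))) ^ 2 := pow_le_pow_left₀ hMnn hMle 2
      have h2 : (2 * (C₁ / Real.sqrt (T - t))) ^ 2 * (T - t) = 4 * C₁ ^ 2 := by
        rw [mul_pow, div_pow, hsq2]
        field_simp
        ring
      nlinarith [h1, hTt.le]
    have h4 : (T - t) * (ν * ‖fderiv ℝ (u t) y‖) ≤ (T - t) * (c * ν / (8 * C₁ ^ 2) * M ^ 2) :=
      mul_le_mul_of_nonneg_left hgrad hTt.le
    have h5 : (T - t) * (c * ν / (8 * C₁ ^ 2) * M ^ 2) ≤ c * ν / (8 * C₁ ^ 2) * (4 * C₁ ^ 2) := by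
      calc (T - t) * (c * ν / (8 * C₁ ^ 2) * M ^ 2)
          = c * ν / (8 * C₁ ^ 2) * (M ^ 2 * (T - t)) := by ring
        _ ≤ c * ν / (8 * C₁ ^ 2) * (4 * C₁ ^ 2) := mul_le_mul_of_nonneg_left hM2le hε.le
    have h6 : c * ν / (8 * C₁ ^ 2) * (4 * C₁ ^ 2) = ν * (c / 2) := by
      field_simp
      ring
    have h3 : ν * ((T - t) * ‖fderiv ℝ (u t) y‖) ≤ ν * (c / 2) := by
      calc ν * ((T - t) * ‖fderiv ℝ (u t) y‖) = (T - t) * (ν * ‖fderiv ℝ (u t) y‖) := by ring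
        _ ≤ ν * (c / 2) := by rw [← h6]; exact h4.trans h5
    exact le_of_mul_le_mul_left h3 hν
  obtain ⟨t, ⟨y, hy⟩, hsm⟩ := (hfreq.and_eventually hsmall).exists
  linarith [hsm y]

end TypeI

/-- **K2 `HorizonTypeIKill` (item stmt-NavierStokesRegularity-32319), PROVED**: Q♭ and the gradient
floor G exclude Type-I blow-up in the frame (`not_typeI_of_blowupHorizon_floor`). -/
theorem horizonTypeIKill_proof : HorizonTypeIKill :=
  fun hQ hG _ν _T hν hT _u _p hmax hLH hdec => not_typeI_of_blowupHorizon_floor hQ hG hν hT hmax hLH hdec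

end Summit.NavierStokesRegularity.NavierStokesRegularity.Theorems.RootDecompLiouvilleHorizonKills
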